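import Mathlib.Algebra.Ring.Parity
import Mathlib.FieldTheory.IsAlgClosed.Spectrum
import Mathlib.GroupTheory.Perm.Fin
import Mathlib.LinearAlgebra.Matrix.Charpoly.Eigs
import Mathlib.NumberTheory.RamificationInertia.Basic
import Mathlib.RingTheory.RamificationInertia.Inertia
import Literature.NumberTheory.Automorphic.SatakeParametersGL
import Literature.NumberTheory.GaloisRepresentations.ProjectiveType
import HarnessLib

/-!
# Tunnell's local lemma: the "order six" argument in the octahedral case of the strong
Artin conjecture

Trunk AutomorphicL / family `lang` (topic `NumberTheory/Automorphic`). This file **proves** the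
elementary local argument by which Tunnell (*Artin's conjecture for representations of
octahedral type*, Bull. AMS 5 (1981), proof of the Theorem, pp. 174–175) identifies Langlands'
candidate `π` with `π(ρ)` for an octahedral `ρ : Gal(F̄/F) → GL_2(ℂ)`, once the two base-change
identities `BC_{E/F}(π) = π(ρ_E)` (quadratic `E/F`) and `BC_{K/F}(π) = π(ρ_K)` (cubic
non-normal `K/F`, Jacquet–Piatetski-Shapiro–Shalika) are known. It is one node of the
decomposition of the named fact `Literature.NumberTheory.Automorphic.langlands_tunnell` (**lang.S30**,
`Automorphic/LanglandsTunnell`) recorded in `Automorphic/StrongArtinGL2`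
(`strongArtin_of_isOctahedralType` = Tunnell's Theorem); the global inputs (Langlands' base
change for `GL(2)`, the cubic lifting, the tetrahedral and dihedral cases) are not restated here.

Informal content (Tunnell 1981, p. 175). Let `v` be a finite place of `F` at which `ρ` and `π`
are unramified, `{a, b}` the eigenvalues of `ρ(Frob_v)` and `{a', b'}` the Satake parameter of
`π_v`. For a place `w | v` of `E` of residue degree `f ∈ {1, 2}` the identity
`BC_{E/F}(π)_w = π(ρ_E)_w` reads `{a'^f, b'^f} = {a^f, b^f}`; for a place `w | v` of `K` of
residue degree `d = d(w) ∈ {1, 3}` (one exists since `[K : F] = 3`) the identity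
`BC_{K/F}(π)_w = π(ρ_K)_w` reads `{a'^d, b'^d} = {a^d, b^d}`. **Claim:** `{a', b'} = {a, b}`,
i.e. `π_v = π(ρ_v)`. *Proof:* if `f = 1` or `d = 1` there is nothing to prove. Otherwise the two
identities force `a' b' = a b` and `{a', b'} = {a ω, b ω}` with `ω = ± 1`; if `ω = -1` and
`{a', b'} ≠ {a, b}`, comparing cubes gives `(a/b)³ = -1` with `a/b ≠ -1`, so `a/b` is a primitive
sixth root of unity and the image of `ρ(Frob_v)` in `PGL_2(ℂ)` has order `6` — impossible, since
the octahedral group `S_4` has no element of order `6` (its elements have order `1, 2, 3` or `4`,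
so `a^k = b^k` for some `1 ≤ k ≤ 4`).

Contents (all proved; no named facts):

* `perm_fin_four_pow_eq_one`: every `σ ∈ S_4` satisfies `σ^k = 1` for some `k ∈ {1, 2, 3, 4}`
  ("`S_4` contains no elements of order 6", Tunnell p. 175), by `decide`.
* `IsOctahedralType.exists_pow_eq_scalar`: if `ρ : G → GL_2(K)` has octahedral projective image
  (`IsOctahedralType`, `GaloisRepresentations/ProjectiveType`) then for every `g` some power
  `ρ(g)^k`, `1 ≤ k ≤ 4`, is scalar; hence (`IsOctahedralType.exists_pow_eq_pow`) any two
  eigenvalues `a, b` of `ρ(g)` satisfy `a^k = b^k` for some `1 ≤ k ≤ 4` (spectral mapping,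
  Mathlib `spectrum.pow_mem_pow`, `spectrum.scalar_eq`).
* `tunnell_eigenvalue_lemma`: the Claim above as a statement about six elements of a field of
  characteristic zero (hypothesis "`a^k = b^k` for some `1 ≤ k ≤ 4`" in place of "octahedral").
* `tunnell_local_lemma`: the Claim for `ρ` of octahedral type, with the eigenvalues of `ρ(g)`
  presented as `charpoly ρ(g) = ∏_{c ∈ {a, b}} (X - c)` (`Automorphic.satakePolynomial`, the
  form in which Frobenius–Satake compatibility is stated in `Automorphic/StrongArtinGL2` and
  `Automorphic/ReciprocityGLn`), and `tunnell_local_lemma_multiset`, the same with the Satake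
  parameter an arbitrary multiset of cardinality two.
* `exists_place_inertiaDeg_eq_one_or_three` ("let `w` be a place of `K` dividing `v`, with
  `[K_w : F_v] = d(w)` … `d(w) = 1` … `d(w) = 3`", Tunnell p. 175): for an extension `K/F` of
  number fields of degree `3` and a finite place `v` of `F` there is a finite place `w | v` of
  `K` of residue degree `1` or `3`; more generally some `w | v` has odd residue degree when
  `[K : F]` is odd (`exists_place_odd_inertiaDeg`), from the fundamental identity
  `∑_{w | v} e_w f_w = [K : F]` (Mathlib `Ideal.sum_ramification_inertia`); and every place of a
  quadratic extension has residue degree `1` or `2` (`inertiaDeg_eq_one_or_two_of_finrank_eq_two`).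
  Places and residue degrees are Mathlib's `HeightOneSpectrum (𝓞 K)`, `Ideal.under`,
  `Ideal.inertiaDeg`, exactly as in **lang.S23** (`Automorphic/BaseChangeGLn`).

## Design notes

* The eigenvalue lemma is pure algebra: the residue degrees `f`, `d` enter as natural numbers
  with `f = 1 ∨ f = 2`, `d = 1 ∨ d = 3`, which is what the last section provides in the
  application. The statements are over an arbitrary field `K` (of characteristic zero for the
  eigenvalue lemma; Tunnell: `K = ℂ`).
* `NoZeroSMulDivisors (𝓞 F) (𝓞 K)` (needed by Mathlib's `Ideal.inertiaDeg_le_finrank`) is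
  derived locally from `Module.IsTorsionFree` (`noZeroSMulDivisors_ringOfIntegers`), the class
  Mathlib now prefers.
* Mathlib has `Equiv.Perm`, `orderOf`, `spectrum`, `Matrix.charpoly`,
  `Matrix.mem_spectrum_iff_isRoot_charpoly`, `spectrum.pow_mem_pow`, `spectrum.scalar_eq` and
  `Matrix.ProjGenLinGroup`; nothing here duplicates a Mathlib declaration (grep `Perm (Fin 4)`
  in Mathlib: only `#eval` examples in `GroupTheory/Perm/Cycle/Concrete`; `octahedral`: nothing).

## References

* J. Tunnell, *Artin's conjecture for representations of octahedral type*, Bull. AMS (N.S.) 5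
  (1981), 173–175: proof of the Theorem, pp. 174–175. [Tunnell1981]
* S. Gelbart, *Three lectures on the modularity of `ρ̄_{E,3}` and the Langlands reciprocity
  conjecture*, in *Modular Forms and Fermat's Last Theorem* (1997), §7.2 (b). [Gelbart1997]
-/

noncomputable section

open scoped MatrixGroups Polynomial
open Polynomial

namespace Literature.NumberTheory.Automorphic

/-! ### `S_4` has no element of order six -/

/-- **The octahedral group contains no elements of order 6** (Tunnell 1981, p. 175), in the
sharper form: every permutation `σ` of four letters satisfies `σ = 1`, `σ² = 1`, `σ³ = 1` or
`σ⁴ = 1` (the cycle types in `S_4` are `1, 2, 3, 4, 2·2`). Proved by kernel decision over the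
`24` elements. [cite: Tunnell1981, proof of Theorem (p. 175)] -/
theorem perm_fin_four_pow_eq_one (σ : Equiv.Perm (Fin 4)) :
    σ = 1 ∨ σ ^ 2 = 1 ∨ σ ^ 3 = 1 ∨ σ ^ 4 = 1 := by
  revert σ
  decide +kernel

/-- Repackaging: every `σ ∈ S_4` has `σ^k = 1` for some `1 ≤ k ≤ 4`. [folklore] -/
theorem perm_fin_four_exists_pow_eq_one (σ : Equiv.Perm (Fin 4)) :
    ∃ k : ℕ, 0 < k ∧ k ≤ 4 ∧ σ ^ k = 1 := by
  rcases perm_fin_four_pow_eq_one σ with h | h | h | h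
  · exact ⟨1, one_pos, by norm_num, by rw [pow_one, h]⟩
  · exact ⟨2, two_pos, by norm_num, h⟩
  · exact ⟨3, three_pos, by norm_num, h⟩
  · exact ⟨4, four_pos, le_rfl, h⟩

/-- No element of `S_4` has order `6`. [cite: Tunnell1981, proof of Theorem (p. 175)] -/
theorem orderOf_perm_fin_four_ne_six (σ : Equiv.Perm (Fin 4)) : orderOf σ ≠ 6 := by
  obtain ⟨k, hk0, hk4, hk⟩ := perm_fin_four_exists_pow_eq_one σ
  intro h6
  have hdvd : orderOf σ ∣ k := orderOf_dvd_of_pow_eq_one hk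
  rw [h6] at hdvd
  have := Nat.le_of_dvd hk0 hdvd
  omega

/-! ### Octahedral type: a small power of every `ρ(g)` is scalar -/

section Octahedral

variable {G : Type*} [Group G] {K : Type*} [Field K]

/-- If `ρ : G → GL_2(K)` has octahedral projective image `\bar ρ(G) ≅ S_4`, then for every
`g ∈ G` some power `ρ(g)^k` with `1 ≤ k ≤ 4` is a scalar matrix (the image of `ρ(g)` in
`PGL_2(K)` has order `1, 2, 3` or `4`; Mathlib `Matrix.ProjGenLinGroup.mk_eq_one`,
`Matrix.GeneralLinearGroup.center_eq_range_scalar`). [cite: Tunnell1981, proof of Theorem (p. 175)] -/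
theorem _root_.Literature.NumberTheory.GaloisRepresentations.IsOctahedralType.exists_pow_eq_scalar {ρ : G →* GL (Fin 2) K} (h : GaloisRepresentations.IsOctahedralType ρ)
    (g : G) : ∃ k : ℕ, 0 < k ∧ k ≤ 4 ∧ ∃ u : Kˣ,
      ρ g ^ k = Matrix.GeneralLinearGroup.scalar (Fin 2) u := by
  obtain ⟨e⟩ := h
  let x : GaloisRepresentations.projectiveImage ρ := ⟨Matrix.ProjGenLinGroup.mk (ρ g), GaloisRepresentations.mk_apply_mem_projectiveImage ρ g⟩
  obtain ⟨k, hk0, hk4, hk⟩ := perm_fin_four_exists_pow_eq_one (e x)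
  have hx : x ^ k = 1 := by
    apply e.injective
    rw [map_pow, hk, map_one]
  have hmk : Matrix.ProjGenLinGroup.mk (ρ g ^ k) = 1 := by
    have hval := congrArg Subtype.val hx
    rw [Subgroup.coe_pow, Subgroup.coe_one] at hval
    rw [map_pow]
    exact hval
  rw [Matrix.ProjGenLinGroup.mk_eq_one, Matrix.GeneralLinearGroup.center_eq_range_scalar] at hmk
  obtain ⟨u, hu⟩ := hmk
  exact ⟨k, hk0, hk4, u, hu.symm⟩

/-- Spectral mapping for a scalar power: if `M^k = c · 1` and `a` is a root of the characteristic
polynomial of the square matrix `M` over a field, then `a^k = c` (Mathlib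
`Matrix.mem_spectrum_iff_isRoot_charpoly`, `spectrum.pow_mem_pow`, `spectrum.scalar_eq`).
[folklore] -/
theorem pow_eq_of_isRoot_charpoly_of_pow_eq_algebraMap {n : Type*} [Fintype n] [DecidableEq n]
    [Nonempty n] {M : Matrix n n K} {k : ℕ} {c a : K}
    (hM : M ^ k = algebraMap K (Matrix n n K) c) (ha : M.charpoly.IsRoot a) : a ^ k = c := by
  have h1 : a ∈ spectrum K M := Matrix.mem_spectrum_iff_isRoot_charpoly.mpr ha
  have h2 : a ^ k ∈ spectrum K (M ^ k) := spectrum.pow_mem_pow M k h1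
  rw [hM, spectrum.scalar_eq] at h2
  exact h2

/-- The scalar element `u · 1 ∈ GL_2(K)` is `algebraMap K (M_2 K) u` as a matrix. [folklore] -/
theorem coe_generalLinearGroup_scalar_eq_algebraMap {n : Type*} [Fintype n] [DecidableEq n]
    (u : Kˣ) : ((Matrix.GeneralLinearGroup.scalar n u : GL n K) : Matrix n n K) =
      algebraMap K (Matrix n n K) u := by
  rw [Matrix.GeneralLinearGroup.coe_scalar, Matrix.algebraMap_eq_diagonal]
  rfl

/-- **Eigenvalue ratios in an octahedral representation have order `≤ 4`**: if
`ρ : G → GL_2(K)` is of octahedral type and `a, b` are roots of the characteristic polynomial of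
`ρ(g)`, then `a^k = b^k` for some `1 ≤ k ≤ 4`; in particular `a / b` is never a primitive sixth
root of unity ("the octahedral group contains no elements of order 6", Tunnell 1981, p. 175).
[cite: Tunnell1981, proof of Theorem (p. 175)] -/
theorem _root_.Literature.NumberTheory.GaloisRepresentations.IsOctahedralType.exists_pow_eq_pow {ρ : G →* GL (Fin 2) K} (h : GaloisRepresentations.IsOctahedralType ρ)
    (g : G) {a b : K} (ha : ((ρ g : GL (Fin 2) K) : Matrix (Fin 2) (Fin 2) K).charpoly.IsRoot a)
    (hb : ((ρ g : GL (Fin 2) K) : Matrix (Fin 2) (Fin 2) K).charpoly.IsRoot b) :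
    ∃ k : ℕ, 0 < k ∧ k ≤ 4 ∧ a ^ k = b ^ k := by
  obtain ⟨k, hk0, hk4, u, hu⟩ := h.exists_pow_eq_scalar g
  have hM : ((ρ g : GL (Fin 2) K) : Matrix (Fin 2) (Fin 2) K) ^ k =
      algebraMap K (Matrix (Fin 2) (Fin 2) K) u := by
    rw [← Units.val_pow_eq_pow_val, hu, coe_generalLinearGroup_scalar_eq_algebraMap]
  exact ⟨k, hk0, hk4, (pow_eq_of_isRoot_charpoly_of_pow_eq_algebraMap hM ha).trans
    (pow_eq_of_isRoot_charpoly_of_pow_eq_algebraMap hM hb).symm⟩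

/-- Eigenvalues of an invertible matrix are non-zero: a root of the characteristic polynomial of
`M ∈ GL_n(K)` is non-zero (Mathlib `spectrum.zero_mem_iff`). [folklore] -/
theorem ne_zero_of_isRoot_charpoly_coe_generalLinearGroup {n : Type*} [Fintype n]
    [DecidableEq n] (M : GL n K) {a : K} (ha : (M : Matrix n n K).charpoly.IsRoot a) : a ≠ 0 := by
  rintro rfl
  have h0 : (0 : K) ∈ spectrum K (M : Matrix n n K) :=
    Matrix.mem_spectrum_iff_isRoot_charpoly.mpr ha
  exact (spectrum.zero_mem_iff K).mp h0 M.isUnit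

end Octahedral

end Literature.NumberTheory.Automorphic

namespace Literature.NumberTheory.Automorphic

open GaloisRepresentations

/-! ### Tunnell's eigenvalue lemma -/

section Algebra

variable {K : Type*} [Field K]

/-- Two unordered pairs in a field with the same sum and the same product coincide (both are
the root multisets of `X² - s X + p`). [folklore] -/
theorem pair_eq_pair_of_sum_eq_of_prod_eq {a b c d : K} (hs : a + b = c + d)
    (hp : a * b = c * d) : ({a, b} : Multiset K) = {c, d} := by
  have h : (a - c) * (a - d) = 0 := by linear_combination a * hs - hp
  rcases mul_eq_zero.mp h with h1 | h1
  · have hac : a = c := sub_eq_zero.mp h1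
    subst hac
    have hbd : b = d := add_left_cancel hs
    rw [hbd]
  · have had : a = d := sub_eq_zero.mp h1
    subst had
    have hbc : b = c := by
      rw [add_comm c a] at hs
      exact add_left_cancel hs
    rw [hbc, Multiset.pair_comm]

/-- Sum of an unordered pair. [folklore] -/
theorem sum_pair (a b : K) : ({a, b} : Multiset K).sum = a + b := by
  simp

/-- Product of an unordered pair. [folklore] -/
theorem prod_pair (a b : K) : ({a, b} : Multiset K).prod = a * b := by
  simp

variable [CharZero K]

/-- **Tunnell's eigenvalue lemma** (Tunnell 1981, proof of the Theorem, p. 175), as pure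
algebra in a field `K` of characteristic zero. Let `a, b ∈ Kˣ` (eigenvalues of `ρ(Frob_v)`) and
`a', b' ∈ K` (Satake parameter of `π_v`) satisfy `{a'^f, b'^f} = {a^f, b^f}` for some
`f ∈ {1, 2}` (from `BC_{E/F}(π) = π(ρ_E)` at a place `w | v` of the quadratic field `E` of
residue degree `f`) and `{a'^d, b'^d} = {a^d, b^d}` for some `d ∈ {1, 3}` (from
`BC_{K/F}(π) = π(ρ_K)` at a place `w | v` of the cubic field `K` of residue degree `d = d(w)`),
and assume `a^k = b^k` for some `1 ≤ k ≤ 4` (no element of order `6` in the projective image,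
`IsOctahedralType.exists_pow_eq_pow`). Then `{a', b'} = {a, b}`. Tunnell's case analysis
(`d(w) = 1`; `d(w) = 3` with `ω = 1`, with `η = 1`, and the impossible case of an element of
order `6`) is carried out here with the power sums `a' + b'`, `a' b'` in place of conjugacy of
diagonal matrices. [cite: Tunnell1981, proof of Theorem (p. 175)] -/
theorem tunnell_eigenvalue_lemma {a b a' b' : K} (ha : a ≠ 0) (hb : b ≠ 0) {f d : ℕ}
    (hf : f = 1 ∨ f = 2) (hd : d = 1 ∨ d = 3)
    (hE : ({a' ^ f, b' ^ f} : Multiset K) = {a ^ f, b ^ f})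
    (hK : ({a' ^ d, b' ^ d} : Multiset K) = {a ^ d, b ^ d})
    (hk : ∃ k : ℕ, 0 < k ∧ k ≤ 4 ∧ a ^ k = b ^ k) :
    ({a', b'} : Multiset K) = {a, b} := by
  -- the cases `f = 1` and `d = 1` are immediate
  rcases hf with rfl | rfl
  · simpa only [pow_one] using hE
  rcases hd with rfl | rfl
  · simpa only [pow_one] using hK
  -- main case `f = 2`, `d = 3`: power sums and products
  have s2 : a' ^ 2 + b' ^ 2 = a ^ 2 + b ^ 2 := by
    rw [← sum_pair, ← sum_pair, hE]
  have p2 : a' ^ 2 * b' ^ 2 = a ^ 2 * b ^ 2 := by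
    rw [← prod_pair, ← prod_pair, hE]
  have s3 : a' ^ 3 + b' ^ 3 = a ^ 3 + b ^ 3 := by
    rw [← sum_pair, ← sum_pair, hK]
  have p3 : a' ^ 3 * b' ^ 3 = a ^ 3 * b ^ 3 := by
    rw [← prod_pair, ← prod_pair, hK]
  -- the products agree: `a' b' = a b` (its square and cube agree with those of `a b ≠ 0`)
  have hab : a * b ≠ 0 := mul_ne_zero ha hb
  have hp : a' * b' = a * b := by
    have h2' : (a' * b') ^ 2 = (a * b) ^ 2 := by rw [mul_pow, mul_pow, p2]
    have h3' : (a' * b') ^ 3 = (a * b) ^ 3 := by rw [mul_pow, mul_pow, p3]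
    have key : (a' * b') * (a * b) ^ 2 = (a * b) * (a * b) ^ 2 := by
      calc (a' * b') * (a * b) ^ 2 = (a' * b') * (a' * b') ^ 2 := by rw [h2']
        _ = (a' * b') ^ 3 := by ring
        _ = (a * b) ^ 3 := h3'
        _ = (a * b) * (a * b) ^ 2 := by ring
    exact mul_right_cancel₀ (pow_ne_zero 2 hab) key
  -- hence `(a' + b')² = (a + b)²`, i.e. `a' + b' = ω (a + b)` with `ω = ± 1`
  have hs2 : (a' + b') ^ 2 = (a + b) ^ 2 := by linear_combination s2 + 2 * hp
  refine pair_eq_pair_of_sum_eq_of_prod_eq ?_ hp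
  rcases sq_eq_sq_iff_eq_or_eq_neg.mp hs2 with h | h
  · exact h
  by_cases hab0 : a + b = 0
  · rw [h, hab0, neg_zero]
  -- `ω = -1` and `a + b ≠ 0`: the cubes force `a² - a b + b² = 0`, i.e. `a / b` of order `6`
  exfalso
  have e1 : a' ^ 3 + b' ^ 3 = -(a + b) ^ 3 + 3 * (a * b) * (a + b) := by
    have : a' ^ 3 + b' ^ 3 = (a' + b') ^ 3 - 3 * (a' * b') * (a' + b') := by ring
    rw [this, h, hp]
    ring
  have e3 : (a + b) ^ 2 = 3 * (a * b) := by
    have h2ab : (2 : K) * (a + b) ≠ 0 := mul_ne_zero two_ne_zero hab0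
    have : 2 * (a + b) * (a + b) ^ 2 = 2 * (a + b) * (3 * (a * b)) := by
      linear_combination e1 - s3
    exact mul_left_cancel₀ h2ab this
  have e4 : a ^ 2 - a * b + b ^ 2 = 0 := by linear_combination e3
  have e5 : a ^ 3 = -b ^ 3 := by linear_combination (a + b) * e4
  obtain ⟨k, hk0, hk4, hk⟩ := hk
  interval_cases k
  · -- `a = b`: then `a² = 0`
    rw [pow_one, pow_one] at hk
    subst hk
    exact ha (pow_eq_zero_iff (n := 2) two_ne_zero |>.mp (by linear_combination e4))
  · -- `a² = b²`: `a = b` as before, or `a = -b` contradicting `a + b ≠ 0`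
    rcases sq_eq_sq_iff_eq_or_eq_neg.mp hk with hk' | hk'
    · subst hk'
      exact ha (pow_eq_zero_iff (n := 2) two_ne_zero |>.mp (by linear_combination e4))
    · exact hab0 (by rw [hk', neg_add_cancel])
  · -- `a³ = b³ = -a³`: then `b³ = 0`
    have : (2 : K) * b ^ 3 = 0 := by linear_combination e5 - hk
    exact hb (pow_eq_zero_iff (n := 3) three_ne_zero |>.mp
      ((mul_eq_zero.mp this).resolve_left two_ne_zero))
  · -- `a⁴ = b⁴` with `a³ = -b³`: then `b³ (a + b) = 0`
    have : b ^ 3 * (a + b) = 0 := by linear_combination a * e5 - hk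
    rcases mul_eq_zero.mp this with h0 | h0
    · exact hb (pow_eq_zero_iff (n := 3) three_ne_zero |>.mp h0)
    · exact hab0 h0

end Algebra

/-! ### Tunnell's local lemma for a representation of octahedral type -/

section Local

variable {G : Type*} [Group G]

/-- The Satake polynomial of a pair: `∏_{c ∈ {a, b}} (X - c) = (X - a)(X - b)`. [folklore] -/
theorem satakePolynomial_pair (a b : ℂ) : satakePolynomial {a, b} = (X - C a) * (X - C b) := by
  simp [satakePolynomial]

/-- `a` is a root of `∏_{c ∈ {a, b}} (X - c)`. [folklore] -/
theorem isRoot_satakePolynomial_pair_left (a b : ℂ) : (satakePolynomial {a, b}).IsRoot a := by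
  rw [satakePolynomial_pair, IsRoot, eval_mul, eval_sub, eval_X, eval_C, sub_self, zero_mul]

/-- `b` is a root of `∏_{c ∈ {a, b}} (X - c)`. [folklore] -/
theorem isRoot_satakePolynomial_pair_right (a b : ℂ) : (satakePolynomial {a, b}).IsRoot b := by
  rw [satakePolynomial_pair, IsRoot, eval_mul]
  simp

/-- **Tunnell's local lemma** (Tunnell 1981, proof of the Theorem, pp. 174–175: "For each place
`v` of `F` such that `ρ_v` is unramified we obtain a diagonal conjugacy class `diag(a_v, b_v)`
in `GL(2, ℂ)`. For each place `v` of `F` such that `π_v` is an unramified principal series we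
obtain a conjugacy class `diag(a'_v, b'_v)` … We must show that `diag(a_v, b_v)` and
`diag(a'_v ω, b'_v ω)` are conjugate. Let `w` be a place of `K` dividing `v`, with
`[K_w : F_v] = d(w)` … If `d(w) = 1`, the desired conjugacy results. If `d(w) = 3`, … gives an
element of order `6` in the projective image of `ρ`. But the octahedral group contains no
elements of order `6`, so this is impossible."). Formally: let `ρ : G → GL_2(ℂ)` be of
octahedral type (`IsOctahedralType`), `g ∈ G` (a Frobenius at `v`) with
`charpoly ρ(g) = ∏_{c ∈ {a, b}} (X - c)` (`Automorphic.satakePolynomial`), and let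
`a', b' ∈ ℂ` (the Satake parameter of `π_v`) satisfy `{a'^f, b'^f} = {a^f, b^f}` for some
`f ∈ {1, 2}` (the identity `BC_{E/F}(π)_w = π(ρ_E)_w` at a place `w | v` of the quadratic
field `E`, of residue degree `f`) and `{a'^d, b'^d} = {a^d, b^d}` for some `d ∈ {1, 3}` (the
identity `BC_{K/F}(π)_w = π(ρ_K)_w` at a place `w | v` of the cubic field `K` of residue
degree `d = d(w)`). Then `{a', b'} = {a, b}`, i.e. `π_v = π(ρ_v)`.
[cite: Tunnell1981, proof of Theorem (pp. 174–175)] -/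
theorem tunnell_local_lemma {ρ : G →* GL (Fin 2) ℂ} (hρ : IsOctahedralType ρ) (g : G)
    {a b a' b' : ℂ}
    (hg : ((ρ g : GL (Fin 2) ℂ) : Matrix (Fin 2) (Fin 2) ℂ).charpoly = satakePolynomial {a, b})
    {f d : ℕ} (hf : f = 1 ∨ f = 2) (hd : d = 1 ∨ d = 3)
    (hE : ({a' ^ f, b' ^ f} : Multiset ℂ) = {a ^ f, b ^ f})
    (hK : ({a' ^ d, b' ^ d} : Multiset ℂ) = {a ^ d, b ^ d}) :
    ({a', b'} : Multiset ℂ) = {a, b} := by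
  have ha : ((ρ g : GL (Fin 2) ℂ) : Matrix (Fin 2) (Fin 2) ℂ).charpoly.IsRoot a := by
    rw [hg]; exact isRoot_satakePolynomial_pair_left a b
  have hb : ((ρ g : GL (Fin 2) ℂ) : Matrix (Fin 2) (Fin 2) ℂ).charpoly.IsRoot b := by
    rw [hg]; exact isRoot_satakePolynomial_pair_right a b
  exact tunnell_eigenvalue_lemma (ne_zero_of_isRoot_charpoly_coe_generalLinearGroup _ ha)
    (ne_zero_of_isRoot_charpoly_coe_generalLinearGroup _ hb) hf hd hE hK
    (hρ.exists_pow_eq_pow g ha hb)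

/-- **Tunnell's local lemma, multiset form**: as `tunnell_local_lemma`, with the Frobenius
eigenvalues and the Satake parameter given as multisets `β`, `α` of cardinality two and the
base-change identities as `α^f = β^f`, `α^d = β^d` (`Multiset.map (· ^ f)`, the form of the
Satake relation in `Lang.exists_baseChange_cyclic`, **lang.S23**). Conclusion: `α = β`.
[cite: Tunnell1981, proof of Theorem (pp. 174–175)] -/
theorem tunnell_local_lemma_multiset {ρ : G →* GL (Fin 2) ℂ} (hρ : IsOctahedralType ρ) (g : G)
    {α β : Multiset ℂ} (hα : Multiset.card α = 2) (hβ : Multiset.card β = 2)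
    (hg : ((ρ g : GL (Fin 2) ℂ) : Matrix (Fin 2) (Fin 2) ℂ).charpoly = satakePolynomial β)
    {f d : ℕ} (hf : f = 1 ∨ f = 2) (hd : d = 1 ∨ d = 3)
    (hE : α.map (· ^ f) = β.map (· ^ f)) (hK : α.map (· ^ d) = β.map (· ^ d)) :
    α = β := by
  obtain ⟨a', b', rfl⟩ := Multiset.card_eq_two.mp hα
  obtain ⟨a, b, rfl⟩ := Multiset.card_eq_two.mp hβ
  simp only [Multiset.insert_eq_cons, Multiset.map_cons, Multiset.map_singleton] at hE hK
  exact tunnell_local_lemma hρ g hg hf hd hE hK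

end Local


/-! ### Places of odd residue degree (Tunnell's `d(w) ∈ {1, 3}`) -/

section Places

open NumberField Ideal IsDedekindDomain

variable {F K : Type*} [Field F] [Field K] [Algebra F K]

/-- `𝓞 K` is a torsion-free `𝓞 F`-module in the sense of `NoZeroSMulDivisors` (from Mathlib's
`Module.IsTorsionFree (𝓞 F) (𝓞 K)` and `smul_eq_zero`). [folklore] -/
theorem noZeroSMulDivisors_ringOfIntegers : NoZeroSMulDivisors (𝓞 F) (𝓞 K) :=
  ⟨fun h => smul_eq_zero.mp h⟩

/-- A prime of `𝓞 K` lying over the finite place `v` of `F` is a finite place of `K` (it is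
non-zero because `𝓞 F → 𝓞 K` is injective). [folklore] -/
theorem exists_heightOneSpectrum_asIdeal_eq_of_mem_primesOver (v : HeightOneSpectrum (𝓞 F))
    {P : Ideal (𝓞 K)} (hP : P ∈ v.asIdeal.primesOver (𝓞 K)) :
    ∃ w : HeightOneSpectrum (𝓞 K), w.asIdeal = P := by
  haveI : P.IsPrime := hP.1
  haveI : P.LiesOver v.asIdeal := hP.2
  have hPne : P ≠ ⊥ := by
    intro h
    apply v.ne_bot
    rw [Ideal.LiesOver.over (P := P) (p := v.asIdeal), h, Ideal.under, Ideal.comap_bot_of_injective]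
    exact FaithfulSMul.algebraMap_injective (𝓞 F) (𝓞 K)
  exact ⟨⟨P, hP.1, hPne⟩, rfl⟩

variable [NumberField F] [NumberField K]

/-- **Odd degree ⇒ a place of odd residue degree.** For an extension `K/F` of number fields of
odd degree and a finite place `v` of `F`, some finite place `w` of `K` above `v`
(`w ∩ 𝓞 F = v`, Mathlib `Ideal.under`) has odd residue degree `f(w|v)` (`Ideal.inertiaDeg`),
and `f(w|v) ≤ [K : F]`: by the fundamental identity `∑_{w | v} e_w f_w = [K : F]` (Mathlib
`Ideal.sum_ramification_inertia`) not all `f_w` can be even. [folklore] -/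
theorem exists_place_odd_inertiaDeg (hodd : Odd (Module.finrank F K))
    (v : HeightOneSpectrum (𝓞 F)) :
    ∃ w : HeightOneSpectrum (𝓞 K), w.asIdeal.under (𝓞 F) = v.asIdeal ∧
      Odd (w.asIdeal.inertiaDeg (𝓞 F)) ∧ w.asIdeal.inertiaDeg (𝓞 F) ≤ Module.finrank F K := by
  classical
  haveI : NoZeroSMulDivisors (𝓞 F) (𝓞 K) := noZeroSMulDivisors_ringOfIntegers
  haveI : v.asIdeal.IsMaximal := v.isPrime.isMaximal v.ne_bot
  have hsum := Ideal.sum_ramification_inertia (R := 𝓞 F) (𝓞 K) F K (p := v.asIdeal) v.ne_bot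
  -- some prime over `v` has odd inertia degree, since the total `[K : F]` is odd
  obtain ⟨P, hP, hPodd⟩ : ∃ P ∈ IsDedekindDomain.primesOverFinset v.asIdeal (𝓞 K),
      Odd (inertiaDeg' v.asIdeal P) := by
    by_contra! hno
    have heven : ∀ P ∈ IsDedekindDomain.primesOverFinset v.asIdeal (𝓞 K),
        Even (ramificationIdx' v.asIdeal P * inertiaDeg' v.asIdeal P) := fun P hP =>
      (Nat.not_odd_iff_even.mp (hno P hP)).mul_left _
    have : Even (Module.finrank F K) := by
      rw [← hsum]
      exact Finset.even_sum _ heven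
    exact (Nat.not_even_iff_odd.mpr hodd) this
  have hP' := (IsDedekindDomain.mem_primesOverFinset_iff v.ne_bot _).mp hP
  haveI : P.IsPrime := hP'.1
  haveI : P.LiesOver v.asIdeal := hP'.2
  obtain ⟨w, rfl⟩ := exists_heightOneSpectrum_asIdeal_eq_of_mem_primesOver v hP'
  haveI : w.asIdeal.IsMaximal := w.isPrime.isMaximal w.ne_bot
  have hle : inertiaDeg' v.asIdeal w.asIdeal ≤ Module.finrank F K :=
    Ideal.inertiaDeg_le_finrank (R := 𝓞 F) (S := 𝓞 K) F K w.asIdeal v.ne_bot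
  rw [inertiaDeg'_eq_inertiaDeg v.asIdeal w.asIdeal] at hPodd hle
  exact ⟨w, (Ideal.LiesOver.over (P := w.asIdeal) (p := v.asIdeal)).symm, hPodd, hle⟩

/-- **Tunnell's `d(w) ∈ {1, 3}`** (Tunnell 1981, p. 175: "Let `w` be a place of `K` dividing
`v`, with `[K_w : F_v] = d(w)` … If `d(w) = 1` … If `d(w) = 3` …"): for a cubic extension `K/F`
of number fields and a finite place `v` of `F` there is a finite place `w` of `K` above `v` of
residue degree `1` or `3`. [cite: Tunnell1981, proof of Theorem (p. 175)] -/
theorem exists_place_inertiaDeg_eq_one_or_three (h3 : Module.finrank F K = 3)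
    (v : HeightOneSpectrum (𝓞 F)) :
    ∃ w : HeightOneSpectrum (𝓞 K), w.asIdeal.under (𝓞 F) = v.asIdeal ∧
      (w.asIdeal.inertiaDeg (𝓞 F) = 1 ∨ w.asIdeal.inertiaDeg (𝓞 F) = 3) := by
  obtain ⟨w, hw, hodd, hle⟩ := exists_place_odd_inertiaDeg (F := F) (K := K) (by rw [h3]; decide) v
  refine ⟨w, hw, ?_⟩
  rw [h3] at hle
  obtain ⟨m, hm⟩ := hodd
  omega

/-- In a quadratic extension `E/F` every finite place `w` above `v` has residue degree
`f(w|v) ∈ {1, 2}` (split or inert/ramified), from `1 ≤ f(w|v) ≤ [E : F] = 2` (Mathlib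
`Ideal.inertiaDeg_le_finrank`, `Ideal.inertiaDeg'_pos`). [folklore] -/
theorem inertiaDeg_eq_one_or_two_of_finrank_eq_two (h2 : Module.finrank F K = 2)
    (v : HeightOneSpectrum (𝓞 F)) (w : HeightOneSpectrum (𝓞 K))
    (hw : w.asIdeal.under (𝓞 F) = v.asIdeal) :
    w.asIdeal.inertiaDeg (𝓞 F) = 1 ∨ w.asIdeal.inertiaDeg (𝓞 F) = 2 := by
  classical
  haveI : NoZeroSMulDivisors (𝓞 F) (𝓞 K) := noZeroSMulDivisors_ringOfIntegers
  haveI : v.asIdeal.IsMaximal := v.isPrime.isMaximal v.ne_bot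
  haveI : w.asIdeal.IsMaximal := w.isPrime.isMaximal w.ne_bot
  haveI : w.asIdeal.LiesOver v.asIdeal := ⟨hw.symm⟩
  have hle : inertiaDeg' v.asIdeal w.asIdeal ≤ Module.finrank F K :=
    Ideal.inertiaDeg_le_finrank (R := 𝓞 F) (S := 𝓞 K) F K w.asIdeal v.ne_bot
  have hpos : 0 < inertiaDeg' v.asIdeal w.asIdeal := inertiaDeg'_pos v.asIdeal w.asIdeal
  rw [inertiaDeg'_eq_inertiaDeg v.asIdeal w.asIdeal] at hle hpos
  rw [h2] at hle
  omega

end Places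

end Literature.NumberTheory.Automorphic
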